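import Summits.FinalStateConjecture.FinalStateConjecture.Theorems.LogTimeThreeAnnuliDyadicCaptureFreezingD
import Literature.Geometry.Lorentzian.QuasiFinalStateDecomposition

/-!
# Route LogTimeThreeAnnuli · crux `DyadicCapture` · line `registered` — `stub_freezingAssembly`

WINDOW FREEZING (the former `stub_windowFreezing` of the line, proved here as the registered
`stub_freezingAssembly : sig₂ → sig₃ → sig₄ → sig(windowFreezing)` from the landed stubs 2–4 and the
parts A–D): windowwise summability of the `Cᵏ` distances of a chart system to the compact window
family `{g_{M,a,Λᵢ,cᵢ} : m₀ ≤ M ≤ 1/m₀, |a| ≤ χM}` — one member per closed dyadic annulus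
`[2^(n₀+n), 2^(n₀+n+1)]`, fixed slab `ρ` and growing slab `Rᵢ(τ)` under the same infimum — yields
FROZEN window parameters `(Mᵢ, aᵢ)` with `Cᵏ` convergence in the same charts, for every `k`, on every
fixed slab and on the growing slabs.

Proof (`freezing_main`, one chart): an instance `(k, ρ)` of the hypothesis gives near-minimisers
`pₙ` (`stub_dyadicSelection`) which converge to some `p∞` of the window, the limit `p∞` being the
unique member whose anchor image is the limit of the member-independent pullback value at the anchor
orbit (part C) — so ALL instances have the same limit; discs stay out of the exterior (part B); on the
`n`-th window the jets of `Ψ^*g − g_{p∞}` are bounded by `3Tₙ` on the fixed slab (part D), whence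
`δᵏ_ρ(τ; p∞) → 0` (smaller `ρ` by monotonicity); on the growing slab the points of rest-frame norm
`< s` lie in the fixed slab of radius `s` and the far points are handled by the uniform far-field
decay (part D), the instance being chosen with `ρ ≥ s(ε)`. The registered statement follows chart by
chart (`d.background i = boostedKerrBackground …` by `rfl`). Sources: Simon, Ann. Math. 118 (1983);
Kerr–Schild 1965.
-/

-- the `Summit.FinalStateConjecture.FinalStateConjecture.…` namespace repeats the summit = sub-problem
-- segment (D-0017 layout, CONVENTIONS §2); the duplicate is deliberate.
set_option linter.dupNamespace false

noncomputable section

namespace Summit.FinalStateConjecture.FinalStateConjecture.Theorems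

open Literature.Geometry.Lorentzian
open scoped Topology Manifold ENNReal ContDiff
open Filter Set

section Main

variable {𝓢 : Spacetime.{0} 4} (Λ : lorentzGroup) (c : E4) (M' a' : ℝ)
  (Ψ : (boostedKerrExterior Λ c M' a') → 𝓢.carrier)

set_option quotPrecheck false in
set_option hygiene false in
/-- The window background of the member `p` over the reference boosted exterior (notation). -/
local notation "Bw⟦" p "⟧" =>
  ({boostedKerrBackground Λ c M' a' with bilin := boostedKerrBilin Λ c (Prod.fst p) (Prod.snd p)} :
    ModelBackground)

set_option quotPrecheck false in
set_option hygiene false in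
/-- The window error of the member `q` on the `n`-th dyadic window (notation). -/
local notation "Ew⟦" R "," k "," ρ "," n₀ "," n "," q "⟧" =>
  (⨆ τ ∈ Set.Icc ((2 : ℝ) ^ (n₀ + n)) ((2 : ℝ) ^ (n₀ + n + 1)),
    (Spacetime.truncDeviationCk 𝓢 Bw⟦q⟧ Ψ k ρ τ + Spacetime.truncDeviationCk 𝓢 Bw⟦q⟧ Ψ k (R τ) τ))

-- long statements; the algebraic / operator-norm instance paths on `E4 →L[ℝ] E4 →L[ℝ] ℝ` unify slowly
set_option synthInstance.maxHeartbeats 200000 in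
set_option maxHeartbeats 1600000 in
/-- **One instance of the hypothesis, unpacked**: near-minimisers `pₙ` in the window with finite window
errors and vanishing tails (`stub_dyadicSelection`), their limit `p∞` in the window with the anchor
pullback value tending to `g_{p∞}(x₀)` (part C), and all discs out of the exterior (part B).
[cite: KerrSchild1965, §2] -/
theorem freezing_instance (hΨ : ContMDiff 𝓘(ℝ, E4) (𝓡 4) ∞ Ψ) {m₀ χ : ℝ} (hm₀ : 0 < m₀) {y₀ : E4}
    (h0 : y₀ 0 = 0) (h1 : y₀ 1 = 0) (h2 : y₀ 2 ≠ 0) (h3 : y₀ 3 ≠ 0)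
    (hy₀ : max (Kerr.rPlus M' a') 0 < Kerr.radius a' y₀) (R : ℝ → ℝ) (k : ℕ) {ρ : ℝ}
    (hρa : Kerr.radius a' y₀ ≤ ρ) (hρA : |χ| * m₀⁻¹ + 1 ≤ ρ) {n₀ : ℕ}
    (hsum : (∑' n : ℕ, ⨅ (M : ℝ) (a : ℝ) (_ : m₀ ≤ M ∧ M ≤ m₀⁻¹ ∧ |a| ≤ χ * M),
      Ew⟦R, k, ρ, n₀, n, (M, a)⟧) ≠ ⊤) :
    ∃ (p : ℕ → ℝ × ℝ) (pinf : ℝ × ℝ),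
      (∀ n, p n ∈ {q : ℝ × ℝ | m₀ ≤ q.1 ∧ q.1 ≤ m₀⁻¹ ∧ |q.2| ≤ χ * q.1}) ∧
      pinf ∈ {q : ℝ × ℝ | m₀ ≤ q.1 ∧ q.1 ≤ m₀⁻¹ ∧ |q.2| ≤ χ * q.1} ∧
      Tendsto p atTop (𝓝 pinf) ∧ (∀ n, Ew⟦R, k, ρ, n₀, n, p n⟧ ≠ ⊤) ∧
      Tendsto (fun n ↦ ∑' j, Ew⟦R, k, ρ, n₀, j + n, p (j + n)⟧) atTop (𝓝 0) ∧
      (∀ n, (p n).2 ^ 2 ≤ a' ^ 2 + max (Kerr.rPlus M' a') 0 ^ 2) ∧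
      pinf.2 ^ 2 ≤ a' ^ 2 + max (Kerr.rPlus M' a') 0 ^ 2 ∧
      Tendsto (fun τ : ℝ ↦ 𝓢.deviationExtend Bw⟦((1 : ℝ), (0 : ℝ))⟧ Ψ
          ((c + (Λ : E4 ≃L[ℝ] E4) y₀) + τ • (Λ : E4 ≃L[ℝ] E4) (EuclideanSpace.single (0 : Fin 4) (1 : ℝ))) +
        boostedKerrBilin Λ c 1 0 (c + (Λ : E4 ≃L[ℝ] E4) y₀)) atTop
        (𝓝 (boostedKerrBilin Λ c pinf.1 pinf.2 (c + (Λ : E4 ≃L[ℝ] E4) y₀))) := by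
  obtain ⟨M, a, hwin, hfin, htail⟩ := dyadicSelection_exists_selection_tendsto
    (fun n M a ↦ Ew⟦R, k, ρ, n₀, n, (M, a)⟧) m₀ χ hsum
  set p : ℕ → ℝ × ℝ := fun n ↦ (M n, a n) with hp
  have hpW : ∀ n, p n ∈ {q : ℝ × ℝ | m₀ ≤ q.1 ∧ q.1 ≤ m₀⁻¹ ∧ |q.2| ≤ χ * q.1} := fun n ↦ hwin n
  have hfin' : ∀ n, Ew⟦R, k, ρ, n₀, n, p n⟧ ≠ ⊤ := fun n ↦ hfin n
  have htail' : Tendsto (fun n ↦ ∑' j, Ew⟦R, k, ρ, n₀, j + n, p (j + n)⟧) atTop (𝓝 0) := htail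
  obtain ⟨pinf, hpinfW, hpt, hPv⟩ := freezing_instance_limit Λ c M' a' Ψ hm₀ h0 h1 h2 h3 hy₀ hρa R k n₀
    hpW hfin' htail'
  -- discs: the fixed-slab distance at the left endpoint of each window is finite
  have hdisc : ∀ n, (p n).2 ^ 2 ≤ a' ^ 2 + max (Kerr.rPlus M' a') 0 ^ 2 := by
    intro n
    have hτ : (2 : ℝ) ^ (n₀ + n) ∈ Set.Icc ((2 : ℝ) ^ (n₀ + n)) ((2 : ℝ) ^ (n₀ + n + 1)) :=
      ⟨le_rfl, pow_le_pow_right₀ one_le_two (Nat.le_succ _)⟩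
    have hle : Spacetime.truncDeviationCk 𝓢 Bw⟦p n⟧ Ψ k ρ ((2 : ℝ) ^ (n₀ + n)) ≤ Ew⟦R, k, ρ, n₀, n, p n⟧ :=
      le_iSup₂_of_le (f := fun τ (_ : τ ∈ Set.Icc ((2 : ℝ) ^ (n₀ + n)) ((2 : ℝ) ^ (n₀ + n + 1))) ↦
        Spacetime.truncDeviationCk 𝓢 Bw⟦p n⟧ Ψ k ρ τ + Spacetime.truncDeviationCk 𝓢 Bw⟦p n⟧ Ψ k (R τ) τ)
        _ hτ le_self_add
    exact freezing_sq_le_of_truncDeviationCk_ne_top Λ c M' a' Ψ hΨ (hm₀.trans_le (hpW n).1)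
      (freezing_abs_le_of_window hm₀ (hpW n)) hρA (ne_top_of_le_ne_top (hfin' n) hle)
  exact ⟨p, pinf, hpW, hpinfW, hpt, hfin', htail', hdisc, freezing_sq_le_of_tendsto hdisc hpt, hPv⟩

-- long statements; the algebraic / operator-norm instance paths on `E4 →L[ℝ] E4 →L[ℝ] ℝ` unify slowly
set_option synthInstance.maxHeartbeats 200000 in
set_option maxHeartbeats 1600000 in
/-- **Fixed slab from an instance**: under the data of an instance `(k, ρ)` with limit `p∞`,
`δᵏ_r(τ; p∞) → 0` for every `r ≤ ρ` (`freezing_fixed_pointwise` on the `n`-th window, tails `→ 0`, every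
late `τ` lies in a late window, monotonicity in the radius). [cite: KerrSchild1965, §2] -/
theorem freezing_tendsto_fixed_of_instance (hΨ : ContMDiff 𝓘(ℝ, E4) (𝓡 4) ∞ Ψ) (R : ℝ → ℝ) (k : ℕ)
    (ρ : ℝ) (n₀ : ℕ) {p : ℕ → ℝ × ℝ} {pinf : ℝ × ℝ}
    (hdisc : ∀ n, (p n).2 ^ 2 ≤ a' ^ 2 + max (Kerr.rPlus M' a') 0 ^ 2)
    (hdisc' : pinf.2 ^ 2 ≤ a' ^ 2 + max (Kerr.rPlus M' a') 0 ^ 2)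
    (hp : Tendsto p atTop (𝓝 pinf)) (hfin : ∀ n, Ew⟦R, k, ρ, n₀, n, p n⟧ ≠ ⊤)
    (htail : Tendsto (fun n ↦ ∑' j, Ew⟦R, k, ρ, n₀, j + n, p (j + n)⟧) atTop (𝓝 0))
    {r : ℝ} (hr : r ≤ ρ) :
    Tendsto (fun τ ↦ Spacetime.truncDeviationCk 𝓢 Bw⟦pinf⟧ Ψ k r τ) atTop (𝓝 0) := by
  rw [ENNReal.tendsto_atTop_zero]
  intro ε hε
  have h3 : Tendsto (fun n ↦ 3 * ∑' j, Ew⟦R, k, ρ, n₀, j + n, p (j + n)⟧) atTop (𝓝 0) := by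
    have := ENNReal.Tendsto.const_mul (a := 3) htail (Or.inr (by simp))
    simpa using this
  obtain ⟨N, hN⟩ := ENNReal.tendsto_atTop_zero.1 h3 ε hε
  refine ⟨(2 : ℝ) ^ (n₀ + N), fun τ hτ ↦ ?_⟩
  obtain ⟨n, hn, hτn⟩ := dyadicSelection_exists_late_window n₀ N τ hτ
  refine le_trans (Spacetime.truncDeviationCk_mono 𝓢 Bw⟦pinf⟧ Ψ k hr τ) (le_trans ?_ (hN n hn))
  show supCkENorm _ k _ ≤ _
  exact iSup₂_le fun m hm ↦ iSup₂_le fun y hy ↦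
    freezing_fixed_pointwise Λ c M' a' Ψ hΨ R hm ρ n₀ hdisc hdisc' hp hfin htail hτn hy

-- long statements; the algebraic / operator-norm instance paths on `E4 →L[ℝ] E4 →L[ℝ] ℝ` unify slowly
set_option synthInstance.maxHeartbeats 200000 in
set_option maxHeartbeats 3200000 in
/-- **Window freezing for one chart** (the analysis of the former `stub_windowFreezing`): a smooth chart
on the reference boosted exterior whose `Cᵏ` distances to the window family are windowwise summable,
for every `k` and `ρ`, from some dyadic index on, converges in every `Cᵏ`, on every fixed slab and on the
growing slabs, to ONE member `(M, a)` of the window. [cite: KerrSchild1965, §2] -/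
theorem freezing_main (hΨ : ContMDiff 𝓘(ℝ, E4) (𝓡 4) ∞ Ψ) (R : ℝ → ℝ) {m₀ χ : ℝ} (hm₀ : 0 < m₀)
    (hW : ∀ (k : ℕ) (ρ : ℝ), ∃ n₀ : ℕ, (∑' n : ℕ, ⨅ (M : ℝ) (a : ℝ)
      (_ : m₀ ≤ M ∧ M ≤ m₀⁻¹ ∧ |a| ≤ χ * M), Ew⟦R, k, ρ, n₀, n, (M, a)⟧) ≠ ⊤) :
    ∃ q : ℝ × ℝ, q ∈ {q : ℝ × ℝ | m₀ ≤ q.1 ∧ q.1 ≤ m₀⁻¹ ∧ |q.2| ≤ χ * q.1} ∧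
      (∀ (k : ℕ) (ρ : ℝ), Tendsto (fun τ ↦ Spacetime.truncDeviationCk 𝓢 Bw⟦q⟧ Ψ k ρ τ) atTop (𝓝 0)) ∧
      (∀ k : ℕ, Tendsto (fun τ ↦ Spacetime.truncDeviationCk 𝓢 Bw⟦q⟧ Ψ k (R τ) τ) atTop (𝓝 0)) := by
  -- anchor and the basic radius
  obtain ⟨y₀, h0, h1, h2, h3, hy₀⟩ := freezing_exists_anchor M' a'
  set ρ₀ : ℝ := max (Kerr.radius a' y₀) (|χ| * m₀⁻¹ + 1) with hρ₀
  -- the base instance defines the frozen member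
  obtain ⟨n₀₀, hsum₀⟩ := hW 0 ρ₀
  obtain ⟨p₀, pinf, -, hpinfW, -, -, -, -, -, hPv0⟩ := freezing_instance Λ c M' a' Ψ hΨ hm₀ h0 h1 h2 h3
    hy₀ R 0 (le_max_left _ _) (le_max_right _ _) hsum₀
  refine ⟨pinf, hpinfW, ?_, ?_⟩
  · -- fixed slabs
    intro k ρ
    set ρ' : ℝ := max ρ ρ₀ with hρ'
    obtain ⟨n₀, hsum⟩ := hW k ρ'
    obtain ⟨p, pinf', -, hpinf'W, hp, hfin, htail, hdisc, hdisc', hPv⟩ := freezing_instance Λ c M' a' Ψ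
      hΨ hm₀ h0 h1 h2 h3 hy₀ R k ((le_max_left _ _).trans (le_max_right ρ ρ₀))
      ((le_max_right _ _).trans (le_max_right ρ ρ₀)) hsum
    have heq : pinf' = pinf := freezing_limit_unique (Λ := Λ) (c := c) hm₀ h1 h2 h3 hpinf'W hpinfW hPv hPv0
    subst heq
    exact freezing_tendsto_fixed_of_instance Λ c M' a' Ψ hΨ R k ρ' n₀ hdisc hdisc' hp hfin htail
      (le_max_left ρ ρ₀)
  · -- growing slabs
    intro k
    rw [ENNReal.tendsto_atTop_zero]
    intro ε hε
    rcases eq_top_or_lt_top ε with hεtop | hεtop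
    · exact ⟨0, fun τ _ ↦ hεtop ▸ le_top⟩
    have hη : 0 < ε.toReal := ENNReal.toReal_pos hε.ne' hεtop.ne
    set η : ℝ := ε.toReal with hηdef
    -- far-field constants for orders `≤ k`, and the far radius
    obtain ⟨C, Rd, hRd, hdecay⟩ := freezing_decay_uniform Λ c χ hm₀ k
    set Cp : ℝ := max C 0 with hCp
    have hCp0 : 0 ≤ Cp := le_max_right _ _
    set Rbig : ℝ := max Rd (6 * Cp / η + 1) with hRbig
    have hRbig0 : 0 < Rbig := lt_max_of_lt_left hRd
    have hdecay' : ∀ m ≤ k, ∀ (M a : ℝ), m₀ ≤ M → M ≤ m₀⁻¹ → |a| ≤ χ * M → ∀ x : E4,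
        Rbig ≤ Kerr.radius a (poincareInv Λ c x) →
        ‖iteratedFDeriv ℝ m (fun y ↦ boostedKerrBilin Λ c M a y - Minkowski.bilin) x‖ ≤
          Cp / Kerr.radius a (poincareInv Λ c x) := by
      intro m hm M a hM1 hM2 ha x hx
      have hr : 0 < Kerr.radius a (poincareInv Λ c x) := hRbig0.trans_le hx
      exact (hdecay m hm M a hM1 hM2 ha x ((le_max_left _ _).trans hx)).trans
        (div_le_div_of_nonneg_right (le_max_left _ _) hr.le)
    have hCR : Cp / Rbig ≤ η / 6 := by
      have h6 : 6 * Cp / η + 1 ≤ Rbig := le_max_right _ _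
      have hη0 : η ≠ 0 := hη.ne'
      rw [div_le_iff₀ hRbig0]
      have h7 : η / 6 * (6 * Cp / η + 1) ≤ η / 6 * Rbig := mul_le_mul_of_nonneg_left h6 (by positivity)
      have h8 : η / 6 * (6 * Cp / η + 1) = Cp + η / 6 := by field_simp
      nlinarith [h7, h8, hη]
    set s : ℝ := Rbig + |χ| * m₀⁻¹ with hs
    have hs0 : 0 ≤ s := by positivity
    have hs2 : Rbig ^ 2 + (|χ| * m₀⁻¹) ^ 2 ≤ s ^ 2 := by
      rw [hs]; nlinarith [hRbig0, abs_nonneg χ, inv_pos.2 hm₀, mul_nonneg (abs_nonneg χ) (inv_pos.2 hm₀).le]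
    -- the instance with `ρ ≥ s`
    set ρε : ℝ := max ρ₀ s with hρε
    obtain ⟨n₀, hsum⟩ := hW k ρε
    obtain ⟨p, pinf', hpW, hpinf'W, hp, hfin, htail, hdisc, hdisc', hPv⟩ := freezing_instance Λ c M' a' Ψ
      hΨ hm₀ h0 h1 h2 h3 hy₀ R k ((le_max_left _ _).trans (le_max_left ρ₀ s))
      ((le_max_right _ _).trans (le_max_left ρ₀ s)) hsum
    have heq : pinf' = pinf := freezing_limit_unique (Λ := Λ) (c := c) hm₀ h1 h2 h3 hpinf'W hpinfW hPv hPv0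
    subst heq
    -- tails: `3 Tₙ ≤ η/2` for `n ≥ N`
    have h3 : Tendsto (fun n ↦ 3 * ∑' j, Ew⟦R, k, ρε, n₀, j + n, p (j + n)⟧) atTop (𝓝 0) := by
      have := ENNReal.Tendsto.const_mul (a := 3) htail (Or.inr (by simp))
      simpa using this
    obtain ⟨N, hN⟩ := ENNReal.tendsto_atTop_zero.1 h3 (ENNReal.ofReal (η / 2)) (ENNReal.ofReal_pos.2 (by linarith))
    refine ⟨(2 : ℝ) ^ (n₀ + N), fun τ hτ ↦ ?_⟩
    obtain ⟨n, hn, hτn⟩ := dyadicSelection_exists_late_window n₀ N τ hτ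
    -- pointwise on the growing slab: near points are in the fixed slab of radius `ρε`, far points decay
    have hpt : ∀ m ≤ k, ∀ y ∈ Subtype.val '' (Bw⟦pinf'⟧).truncTimeSlab (R τ) τ,
        ‖iteratedFDeriv ℝ m (𝓢.deviationExtend Bw⟦pinf'⟧ Ψ) y‖ₑ ≤
          ENNReal.ofReal (η / 2) + ENNReal.ofReal (η / 3) := by
      intro m hm y hy
      rcases lt_or_ge (E4.spatialNorm (poincareInv Λ c y)) s with hnear | hfar
      · -- near: `r_{a'} ≤ |ỹ| < s ≤ ρε`
        have hy' : y ∈ Subtype.val '' (Bw⟦pinf'⟧).truncTimeSlab ρε τ := by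
          rw [freezing_mem_slab_iff] at hy ⊢
          exact ⟨hy.1, hy.2.1, ((Kerr.radius_le_spatialNorm a' _).trans hnear.le).trans (le_max_right _ _)⟩
        calc ‖iteratedFDeriv ℝ m (𝓢.deviationExtend Bw⟦pinf'⟧ Ψ) y‖ₑ
            ≤ 3 * ∑' j, Ew⟦R, k, ρε, n₀, j + n, p (j + n)⟧ :=
              freezing_fixed_pointwise Λ c M' a' Ψ hΨ R hm ρε n₀ hdisc hdisc' hp hfin htail hτn hy'
          _ ≤ ENNReal.ofReal (η / 2) := hN n hn
          _ ≤ ENNReal.ofReal (η / 2) + ENNReal.ofReal (η / 3) := le_self_add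
      · -- far
        calc ‖iteratedFDeriv ℝ m (𝓢.deviationExtend Bw⟦pinf'⟧ Ψ) y‖ₑ
            ≤ Ew⟦R, k, ρε, n₀, n, p n⟧ + 2 * ENNReal.ofReal (Cp / Rbig) :=
              freezing_far_pointwise Λ c M' a' Ψ hΨ hm₀ R hm ρε n₀ hpW hpinfW hRbig0 hdecay' hs2 hs0 hτn hy hfar
          _ ≤ ENNReal.ofReal (η / 2) + ENNReal.ofReal (η / 3) := by
              refine add_le_add ?_ ?_
              · refine le_trans ?_ (hN n hn)
                refine (freezing_le_tail (fun j ↦ Ew⟦R, k, ρε, n₀, j, p j⟧) n).trans ?_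
                have : (∑' j, Ew⟦R, k, ρε, n₀, j + n, p (j + n)⟧) ≤ 3 * ∑' j, Ew⟦R, k, ρε, n₀, j + n, p (j + n)⟧ :=
                  le_mul_of_one_le_left zero_le (by norm_num)
                exact this
              · rw [← ENNReal.ofReal_ofNat 2, ← ENNReal.ofReal_mul (by norm_num)]
                exact ENNReal.ofReal_le_ofReal (by linarith)
    calc Spacetime.truncDeviationCk 𝓢 Bw⟦pinf'⟧ Ψ k (R τ) τ
        ≤ ENNReal.ofReal (η / 2) + ENNReal.ofReal (η / 3) := by
          show supCkENorm _ k _ ≤ _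
          exact iSup₂_le fun m hm ↦ iSup₂_le fun y hy ↦ hpt m hm y hy
      _ = ENNReal.ofReal (η / 2 + η / 3) := (ENNReal.ofReal_add (by linarith) (by linarith)).symm
      _ ≤ ENNReal.ofReal η := ENNReal.ofReal_le_ofReal (by linarith)
      _ = ε := ENNReal.ofReal_toReal hεtop.ne

end Main

/-! ### The registered stub -/

-- the structure-update backgrounds of the registered signature unfold `d.background i` slowly
set_option synthInstance.maxHeartbeats 200000 in
set_option maxHeartbeats 3200000 in
/-- **`stub_freezingAssembly`** (registered stub 5 of the line `registered` for the crux `DyadicCapture`):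
the three landed Kerr–Schild / bookkeeping stubs imply WINDOW FREEZING verbatim — windowwise summability
of the `Cᵏ` distances of a chart system to the compact window family yields frozen window parameters
`(Mᵢ, aᵢ)` with `Cᵏ` convergence in the same charts on fixed and growing slabs. Chart by chart this is
`freezing_main` (`d.background i = boostedKerrBackground (d.motion i).1 (d.motion i).2 (d.mass i) (d.spin i)`
by `rfl`); the hypotheses are the landed `stub_kerrSchildRigidity`, `stub_kerrSchildJets`,
`stub_dyadicSelection`, used through their tree versions. [cite: KerrSchild1965, §2] -/
theorem stub_freezingAssembly : ((∀ (y₀ : E4), y₀ 1 = 0 → y₀ 2 ≠ 0 → y₀ 3 ≠ 0 → ∀ (M a M' a' : ℝ), 0 < M → 0 < M' → Kerr.bilin M a y₀ = Kerr.bilin M' a' y₀ → M = M' ∧ a = a') ∧ (∀ (y₀ : E4), y₀ 3 ≠ 0 → Continuous (fun p : ℝ × ℝ => Kerr.bilin p.1 p.2 y₀)) ∧ (∀ (M a : ℝ), 0 < M → ∀ (y : E4), y 3 = 0 → y 1 ^ 2 + y 2 ^ 2 = a ^ 2 → ∀ (C : ℝ), ∀ U ∈ nhds y, ∃ y' ∈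 U, y' 0 = y 0 ∧ 0 < Kerr.radius a y' ∧ C ≤ Kerr.scalarH M a y')) → ((∀ (Λ : lorentzGroup) (c x : E4) (p₀ : ℝ × ℝ) (m : ℕ), 0 < Kerr.radius p₀.2 (poincareInv Λ c x) → ContinuousAt (fun p : ℝ × ℝ => iteratedFDeriv ℝ m (boostedKerrBilin Λ c p.1 p.2) x) p₀) ∧ (∀ (Λ : lorentzGroup) (c : E4) (m : ℕ) (m₀ χ : ℝ), 0 < m₀ → ∃ C R₀ : ℝ, 0 < R₀ ∧ ∀ (M a : ℝ), m₀ ≤ M → M ≤ m₀⁻¹ → |a| ≤ χ * M → ∀ x : E4, R₀ ≤ Kerr.radius a (poincareInv Λ c x) → ‖iteratedFDeriv ℝ m (fun y => boostedKerrBilin Λ c M a y - Minkowski.bilin) x‖ ≤ C / Kerr.radius a (poincareInv Λ c x))) → ((∀ (e : ℕ → ℝ → ℝ → ENNReal) (m₀ χ : ℝ), (∑' n : ℕ, ⨅ (M : ℝ) (a : ℝ) (_ : m₀ ≤ M ∧ M ≤ m₀⁻¹ ∧ |a| ≤ χ * M), e n M a) ≠ ⊤ → ∃ (M a : ℕ →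 ℝ), (∀ n, m₀ ≤ M n ∧ M n ≤ m₀⁻¹ ∧ |a n| ≤ χ * M n) ∧ (∀ n, e n (M n) (a n) ≠ ⊤) ∧ Filter.Tendsto (fun n => ∑' j : ℕ, e (j + n) (M (j + n)) (a (j + n))) Filter.atTop (nhds 0)) ∧ (∀ (n₀ N : ℕ) (τ : ℝ), (2 : ℝ) ^ (n₀ + N) ≤ τ → ∃ n : ℕ, N ≤ n ∧ τ ∈ Set.Icc ((2 : ℝ) ^ (n₀ + n)) ((2 : ℝ) ^ (n₀ + n + 1)))) → ∀ (𝓢 : Spacetime.{0} 4) (O : Set 𝓢.carrier) (d : QuasiFinalStateDecomposition 𝓢 O 2 ⊤) (R : Fin d.N → ℝ → ℝ) (m₀ χ : ℝ), 0 < m₀ → χ < 1 → (∀ (i : Fin d.N) (k : ℕ) (ρ : ℝ), ∃ n₀ : ℕ, (∑' n : ℕ, ⨅ (M : ℝ) (a : ℝ) (_ : m₀ ≤ M ∧ M ≤ m₀⁻¹ ∧ |a| ≤ χ * M), ⨆ τ ∈ Set.Icc ((2 : ℝ) ^ (n₀ + n)) ((2 : ℝ) ^ (n₀ + n + 1)),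 (𝓢.truncDeviationCk {d.background i with bilin := boostedKerrBilin (d.motion i).1 (d.motion i).2 M a} (d.chart i) k ρ τ + 𝓢.truncDeviationCk {d.background i with bilin := boostedKerrBilin (d.motion i).1 (d.motion i).2 M a} (d.chart i) k (R i τ) τ)) ≠ ⊤) → ∃ (M a : Fin d.N → ℝ), (∀ i : Fin d.N, m₀ ≤ M i ∧ M i ≤ m₀⁻¹ ∧ |a i| ≤ χ * M i) ∧ (∀ (i : Fin d.N) (k : ℕ) (ρ : ℝ), Filter.Tendsto (fun τ => 𝓢.truncDeviationCk {d.background i with bilin := boostedKerrBilin (d.motion i).1 (d.motion i).2 (M i) (a i)} (d.chart i) k ρ τ) Filter.atTop (nhds 0)) ∧ (∀ (i : Fin d.N) (k : ℕ), Filter.Tendsto (fun τ => 𝓢.truncDeviationCk {d.background i with bilin := boostedKerrBilin (d.motion i).1 (d.motion i).2 (M i) (a i)} (d.chart i) k (R i τ) τ) Filter.atTop (nhds 0)) := by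
  intro _ _ _ 𝓢 O d R m₀ χ hm₀ _ hW
  have key : ∀ i : Fin d.N, ∃ M a : ℝ, (m₀ ≤ M ∧ M ≤ m₀⁻¹ ∧ |a| ≤ χ * M) ∧
      (∀ (k : ℕ) (ρ : ℝ), Filter.Tendsto (fun τ => 𝓢.truncDeviationCk {d.background i with
        bilin := boostedKerrBilin (d.motion i).1 (d.motion i).2 M a} (d.chart i) k ρ τ)
        Filter.atTop (nhds 0)) ∧
      (∀ k : ℕ, Filter.Tendsto (fun τ => 𝓢.truncDeviationCk {d.background i with
        bilin := boostedKerrBilin (d.motion i).1 (d.motion i).2 M a} (d.chart i) k (R i τ) τ)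
        Filter.atTop (nhds 0)) := by
    intro i
    have hWi := hW i
    unfold QuasiFinalStateDecomposition.background at hWi ⊢
    obtain ⟨q, hq, hfix, hgrow⟩ := freezing_main (d.motion i).1 (d.motion i).2 (d.mass i) (d.spin i)
      (d.chart i) (d.isLateChart i).contMDiff (R i) hm₀ hWi
    exact ⟨q.1, q.2, hq, hfix, hgrow⟩
  choose M a hMa hfix hgrow using key
  exact ⟨M, a, hMa, hfix, hgrow⟩

end Summit.FinalStateConjecture.FinalStateConjecture.Theorems

end
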